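import Summits.FinalStateConjecture.FinalStateConjecture.Theorems.EIHFluxBalanceInertialRecessionStubCoerMomQuantVar
import Summits.FinalStateConjecture.FinalStateConjecture.Theorems.EIHFluxBalanceInertialRecessionStubCoerMomQuantJets

/-!
# Route EIHFluxBalance — `InertialRecession` (E′), line `SketchCleanExcision`, skeleton r13,
# stub `stub_coerMomQuant` (Bs): continuity of the momentum rows in (background 2-jet, frame,
# motion) — the limit step of the compactness argument

Helper file for the crux `stmt-FinalStateConjecture-17403`
(`Summit.FinalStateConjecture.FinalStateConjecture.Theses.EIHFluxBalance.InertialRecession`, E′),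
registered stub `stub_coerMomQuant` (Bs) of skeleton r13. The momentum row
`Ric(G + x⁰Var)(x)(♯_G dx⁰, e) − Ric(G)(x)(♯_G dx⁰, e)` of the first-order modulated model is a
continuous function of the 2-jet of `G` at `x` (on jets with invertible value), of
`(Var(x), DVar(x))`, hence of the frame `S = Λ⁻¹` and the motion `(A, d)`:

* `coerMomQ_row_eq_ricciJet` — the row through the Ricci jet function `MetricCoord.ricciJet`
  and `♯ = (G x)⁻¹` (`ricAt_eq_ricciJet`, jets of `coerMomQ_jets_add_slice_smul`);
* `coerMomQ_tendsto_row` — **limit step**: along sequences `Sₙ → S₀`, `(Aₙ, dₙ) → (A₀, d₀)` and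
  metric components `Gₙ` whose 2-jets at `x` approach those of the painted summands with frames
  `Sₙ`, the rows converge to the row of the painted summand with frame `S₀` and motion `(A₀, d₀)`.

Elementary; no definitions, no named facts, no `sorry`.
-/

set_option linter.dupNamespace false
set_option maxSynthPendingDepth 6
set_option synthInstance.maxHeartbeats 200000

noncomputable section

open Set Function Filter Literature.Geometry.Lorentzian Literature.Geometry.Lorentzian.MetricCoord
open scoped Topology ContDiff

namespace Summit.FinalStateConjecture.FinalStateConjecture.Theorems.SublinearIsFree.Slaving

/-! ### The row through the Ricci jet function -/

/-- Packaging of the second-jet shift `v ↦ v⁰ P + dx⁰ ⊗ P(v)` as a continuous linear map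
`dx⁰ ⊗ P + (dx⁰ ⊗ ·) ∘ P`. [folklore] -/
theorem coerMomQ_jet₂_shift_eq {F : Type*} [NormedAddCommGroup F] [NormedSpace ℝ F]
    {D D' : E4 →L[ℝ] E4 →L[ℝ] F} {P : E4 →L[ℝ] F}
    (h : ∀ v : E4, D' v = D v + ((E4.dx 0) v • P + (E4.dx 0).smulRight (P v)
      + (E4.dx 0) v • (E4.dx 0).smulRight (0 : F))) :
    D' = D + ((E4.dx 0).smulRight P
      + (ContinuousLinearMap.smulRightL ℝ E4 F (E4.dx 0)).comp P) := by
  ext v w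
  rw [h v]
  simp [ContinuousLinearMap.smulRight_apply]

set_option maxHeartbeats 1600000 in
/-- **The momentum row of the modulated model through the Ricci jet function.** At a slice point
`x` (`x⁰ = 0`) of the domain of the metric components `G` with positive painted radius,
`Ric(G + x⁰Var)(x)(♯dx⁰, e) − Ric(G)(x)(♯dx⁰, e)` equals the Ricci jet function at the shifted jet
`(G x, DG x + dx⁰ ⊗ Var x, D²G x + dx⁰ ⊗ DVar x + (dx⁰ ⊗ DVar x)ᵗ)` minus its value at the jet of
`G`, both evaluated on `((G x)⁻¹ dx⁰, e)`. [cite: ONeill1983, Ch. 3, Lemma 3.52] -/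
theorem coerMomQ_row_eq_ricciJet {G : E4 → E4 →L[ℝ] E4 →L[ℝ] ℝ} {V : Set E4} {x : E4}
    (hG : IsMetricOn G V) (hxV : x ∈ V) (hx0 : x 0 = 0) (M a : ℝ) (S A : E4 →L[ℝ] E4) (d : E4)
    (hx : 0 < Kerr.radius a (S x)) (e : E4) :
    (ricAt (fun z : E4 ↦ G z + (z 0) • ((fderiv ℝ (Kerr.bilin M a) (S z) (A (S z) + d)).bilinearComp S S + (Kerr.bilin M a (S z)).bilinearComp (A.comp S) S + (Kerr.bilin M a (S z)).bilinearComp S (A.comp S))) x (sharpAt G x (E4.dx 0)) e - ricAt G x (sharpAt G x (E4.dx 0)) e)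
      = ricciJet (x, G x, fderiv ℝ G x + (E4.dx 0).smulRight ((fun z : E4 ↦ ((fderiv ℝ (Kerr.bilin M a) (S z) (A (S z) + d)).bilinearComp S S + (Kerr.bilin M a (S z)).bilinearComp (A.comp S) S + (Kerr.bilin M a (S z)).bilinearComp S (A.comp S))) x),
          fderiv ℝ (fderiv ℝ G) x + ((E4.dx 0).smulRight (fderiv ℝ (fun z : E4 ↦ ((fderiv ℝ (Kerr.bilin M a) (S z) (A (S z) + d)).bilinearComp S S + (Kerr.bilin M a (S z)).bilinearComp (A.comp S) S + (Kerr.bilin M a (S z)).bilinearComp S (A.comp S))) x)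
            + (ContinuousLinearMap.smulRightL ℝ E4 (E4 →L[ℝ] E4 →L[ℝ] ℝ) (E4.dx 0)).comp
              (fderiv ℝ (fun z : E4 ↦ ((fderiv ℝ (Kerr.bilin M a) (S z) (A (S z) + d)).bilinearComp S S + (Kerr.bilin M a (S z)).bilinearComp (A.comp S) S + (Kerr.bilin M a (S z)).bilinearComp S (A.comp S))) x))) (sharpAt G x (E4.dx 0)) e
        - ricciJet (x, G x, fderiv ℝ G x, fderiv ℝ (fderiv ℝ G) x) (sharpAt G x (E4.dx 0)) e := by
  obtain ⟨Φ, hΦ⟩ : ∃ Φ : E4 → E4 →L[ℝ] E4 →L[ℝ] ℝ, Φ = fun z ↦ ((fderiv ℝ (Kerr.bilin M a) (S z) (A (S z) + d)).bilinearComp S S + (Kerr.bilin M a (S z)).bilinearComp (A.comp S) S + (Kerr.bilin M a (S z)).bilinearComp S (A.comp S)) := ⟨_, rfl⟩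
  rw [← hΦ]
  have h1 : (fun z : E4 ↦ G z + (z 0) • ((fderiv ℝ (Kerr.bilin M a) (S z) (A (S z) + d)).bilinearComp S S + (Kerr.bilin M a (S z)).bilinearComp (A.comp S) S + (Kerr.bilin M a (S z)).bilinearComp S (A.comp S))) = fun z ↦ G z + (z 0) • Φ z := by
    subst hΦ; rfl
  rw [h1]
  -- smoothness and symmetry of `Φ` on `U = {r(S·) > 0}`
  obtain ⟨hU, hΦc⟩ := coerMomQ_contDiffOn_var M a S A d
  rw [← hΦ] at hΦc
  have hΦs : ∀ z ∈ {z : E4 | 0 < Kerr.radius a (S z)}, ∀ v w : E4, Φ z v w = Φ z w v :=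
    fun z hz v w ↦ by rw [hΦ]; exact coerMomQ_var_symm M a S A d hz v w
  have hpack := coerMomQ_isMetricOn_add_slice_smul hG hxV hx0 hΦc hU hx hΦs
  obtain ⟨V', hV'o, hxV', -, hV'U, hG', hG₁⟩ := hpack
  have hjets := coerMomQ_jets_add_slice_smul hG'.contDiffOn (hΦc.mono hV'U) hV'o hxV' hx0
  obtain ⟨-, h11, h12⟩ := hjets
  have h12' := coerMomQ_jet₂_shift_eq h12
  have e1 : ricAt (fun z : E4 ↦ G z + (z 0) • Φ z) x = ricciJet (x, G x,
      fderiv ℝ G x + (E4.dx 0).smulRight (Φ x),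
      fderiv ℝ (fderiv ℝ G) x + ((E4.dx 0).smulRight (fderiv ℝ Φ x)
        + (ContinuousLinearMap.smulRightL ℝ E4 (E4 →L[ℝ] E4 →L[ℝ] ℝ) (E4.dx 0)).comp
          (fderiv ℝ Φ x))) := by
    rw [ricAt_eq_ricciJet hG₁ hxV', h11, h12', hx0, zero_smul, add_zero]
  have e2 : ricAt G x = ricciJet (x, G x, fderiv ℝ G x, fderiv ℝ (fderiv ℝ G) x) :=
    ricAt_eq_ricciJet hG' hxV'
  rw [e1, e2]

/-! ### Continuity bookkeeping -/

/-- Joint continuity of evaluation: `fₙ → f`, `uₙ → u` imply `fₙ uₙ → f u` for continuous linear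
maps. [folklore] -/
theorem coerMomQ_tendsto_clm_apply {E' F' : Type*} [NormedAddCommGroup E'] [NormedSpace ℝ E']
    [NormedAddCommGroup F'] [NormedSpace ℝ F'] {ι : Type*} {l : Filter ι}
    {f : ι → E' →L[ℝ] F'} {g : ι → E'} {φ : E' →L[ℝ] F'} {u : E'}
    (hf : Tendsto f l (𝓝 φ)) (hg : Tendsto g l (𝓝 u)) :
    Tendsto (fun i ↦ f i (g i)) l (𝓝 (φ u)) := by
  have hc : Continuous fun p : (E' →L[ℝ] F') × E' ↦ p.1 p.2 := isBoundedBilinearMap_apply.continuous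
  exact (hc.tendsto (φ, u)).comp (hf.prodMk_nhds hg)

set_option maxHeartbeats 400000 in
/-- **Continuity of the row functional on jets with invertible value.** The map
`(j, q, P) ↦ ricciJet(j₁, j₂ + dx⁰ ⊗ q, j₃ + dx⁰ ⊗ P + (dx⁰ ⊗ P)ᵗ)((j₁)⁻¹dx⁰, e) − ricciJet(j)((j₁)⁻¹dx⁰, e)`
is continuous at every `(j, q, P)` with `j₁` invertible (`contDiffOn_ricciJet`,
`IsInvertible.contDiffAt_map_inverse`). [folklore] -/
theorem coerMomQ_continuousAt_rowFun (e : E4)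
    {w₀ : (E4 × (E4 →L[ℝ] E4 →L[ℝ] ℝ) × (E4 →L[ℝ] E4 →L[ℝ] E4 →L[ℝ] ℝ)
      × (E4 →L[ℝ] E4 →L[ℝ] E4 →L[ℝ] E4 →L[ℝ] ℝ))
      × ((E4 →L[ℝ] E4 →L[ℝ] ℝ) × (E4 →L[ℝ] E4 →L[ℝ] E4 →L[ℝ] ℝ))}
    (hw₀ : w₀.1.2.1.IsInvertible) :
    ContinuousAt (fun w : (E4 × (E4 →L[ℝ] E4 →L[ℝ] ℝ) × (E4 →L[ℝ] E4 →L[ℝ] E4 →L[ℝ] ℝ)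
        × (E4 →L[ℝ] E4 →L[ℝ] E4 →L[ℝ] E4 →L[ℝ] ℝ))
        × ((E4 →L[ℝ] E4 →L[ℝ] ℝ) × (E4 →L[ℝ] E4 →L[ℝ] E4 →L[ℝ] ℝ)) ↦
      ricciJet (w.1.1, w.1.2.1, w.1.2.2.1 + (E4.dx 0).smulRight w.2.1,
          w.1.2.2.2 + ((E4.dx 0).smulRight w.2.2
            + (ContinuousLinearMap.smulRightL ℝ E4 (E4 →L[ℝ] E4 →L[ℝ] ℝ) (E4.dx 0)).comp w.2.2))
          (w.1.2.1.inverse (E4.dx 0)) e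
        - ricciJet w.1 (w.1.2.1.inverse (E4.dx 0)) e) w₀ := by
  -- the two jet arguments as continuous functions of `w`
  have hJ : Continuous fun w : (E4 × (E4 →L[ℝ] E4 →L[ℝ] ℝ) × (E4 →L[ℝ] E4 →L[ℝ] E4 →L[ℝ] ℝ)
        × (E4 →L[ℝ] E4 →L[ℝ] E4 →L[ℝ] E4 →L[ℝ] ℝ))
        × ((E4 →L[ℝ] E4 →L[ℝ] ℝ) × (E4 →L[ℝ] E4 →L[ℝ] E4 →L[ℝ] ℝ)) ↦
      ((w.1.1, w.1.2.1, w.1.2.2.1 + (E4.dx 0).smulRight w.2.1,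
          w.1.2.2.2 + ((E4.dx 0).smulRight w.2.2
            + (ContinuousLinearMap.smulRightL ℝ E4 (E4 →L[ℝ] E4 →L[ℝ] ℝ) (E4.dx 0)).comp w.2.2)) :
        E4 × (E4 →L[ℝ] E4 →L[ℝ] ℝ) × (E4 →L[ℝ] E4 →L[ℝ] E4 →L[ℝ] ℝ)
          × (E4 →L[ℝ] E4 →L[ℝ] E4 →L[ℝ] E4 →L[ℝ] ℝ)) := by
    have hq : Continuous fun w : (E4 × (E4 →L[ℝ] E4 →L[ℝ] ℝ) × (E4 →L[ℝ] E4 →L[ℝ] E4 →L[ℝ] ℝ)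
        × (E4 →L[ℝ] E4 →L[ℝ] E4 →L[ℝ] E4 →L[ℝ] ℝ))
        × ((E4 →L[ℝ] E4 →L[ℝ] ℝ) × (E4 →L[ℝ] E4 →L[ℝ] E4 →L[ℝ] ℝ)) ↦ w.2.1 := by fun_prop
    have hP : Continuous fun w : (E4 × (E4 →L[ℝ] E4 →L[ℝ] ℝ) × (E4 →L[ℝ] E4 →L[ℝ] E4 →L[ℝ] ℝ)
        × (E4 →L[ℝ] E4 →L[ℝ] E4 →L[ℝ] E4 →L[ℝ] ℝ))
        × ((E4 →L[ℝ] E4 →L[ℝ] ℝ) × (E4 →L[ℝ] E4 →L[ℝ] E4 →L[ℝ] ℝ)) ↦ w.2.2 := by fun_prop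
    have h1 : Continuous fun w : (E4 × (E4 →L[ℝ] E4 →L[ℝ] ℝ) × (E4 →L[ℝ] E4 →L[ℝ] E4 →L[ℝ] ℝ)
        × (E4 →L[ℝ] E4 →L[ℝ] E4 →L[ℝ] E4 →L[ℝ] ℝ))
        × ((E4 →L[ℝ] E4 →L[ℝ] ℝ) × (E4 →L[ℝ] E4 →L[ℝ] E4 →L[ℝ] ℝ)) ↦
        (E4.dx 0).smulRight w.2.1 :=
      (ContinuousLinearMap.smulRightL ℝ E4 (E4 →L[ℝ] E4 →L[ℝ] ℝ) (E4.dx 0)).continuous.comp hq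
    have h2 : Continuous fun w : (E4 × (E4 →L[ℝ] E4 →L[ℝ] ℝ) × (E4 →L[ℝ] E4 →L[ℝ] E4 →L[ℝ] ℝ)
        × (E4 →L[ℝ] E4 →L[ℝ] E4 →L[ℝ] E4 →L[ℝ] ℝ))
        × ((E4 →L[ℝ] E4 →L[ℝ] ℝ) × (E4 →L[ℝ] E4 →L[ℝ] E4 →L[ℝ] ℝ)) ↦
        (E4.dx 0).smulRight w.2.2 :=
      (ContinuousLinearMap.smulRightL ℝ E4 (E4 →L[ℝ] E4 →L[ℝ] E4 →L[ℝ] ℝ) (E4.dx 0)).continuous.comp hP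
    have h3 : Continuous fun w : (E4 × (E4 →L[ℝ] E4 →L[ℝ] ℝ) × (E4 →L[ℝ] E4 →L[ℝ] E4 →L[ℝ] ℝ)
        × (E4 →L[ℝ] E4 →L[ℝ] E4 →L[ℝ] E4 →L[ℝ] ℝ))
        × ((E4 →L[ℝ] E4 →L[ℝ] ℝ) × (E4 →L[ℝ] E4 →L[ℝ] E4 →L[ℝ] ℝ)) ↦
        (ContinuousLinearMap.smulRightL ℝ E4 (E4 →L[ℝ] E4 →L[ℝ] ℝ) (E4.dx 0)).comp w.2.2 :=
      continuous_const.clm_comp hP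
    have hx : Continuous fun w : (E4 × (E4 →L[ℝ] E4 →L[ℝ] ℝ) × (E4 →L[ℝ] E4 →L[ℝ] E4 →L[ℝ] ℝ)
        × (E4 →L[ℝ] E4 →L[ℝ] E4 →L[ℝ] E4 →L[ℝ] ℝ))
        × ((E4 →L[ℝ] E4 →L[ℝ] ℝ) × (E4 →L[ℝ] E4 →L[ℝ] E4 →L[ℝ] ℝ)) ↦ w.1.1 := by fun_prop
    have hg : Continuous fun w : (E4 × (E4 →L[ℝ] E4 →L[ℝ] ℝ) × (E4 →L[ℝ] E4 →L[ℝ] E4 →L[ℝ] ℝ)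
        × (E4 →L[ℝ] E4 →L[ℝ] E4 →L[ℝ] E4 →L[ℝ] ℝ))
        × ((E4 →L[ℝ] E4 →L[ℝ] ℝ) × (E4 →L[ℝ] E4 →L[ℝ] E4 →L[ℝ] ℝ)) ↦ w.1.2.1 := by fun_prop
    have hg' : Continuous fun w : (E4 × (E4 →L[ℝ] E4 →L[ℝ] ℝ) × (E4 →L[ℝ] E4 →L[ℝ] E4 →L[ℝ] ℝ)
        × (E4 →L[ℝ] E4 →L[ℝ] E4 →L[ℝ] E4 →L[ℝ] ℝ))
        × ((E4 →L[ℝ] E4 →L[ℝ] ℝ) × (E4 →L[ℝ] E4 →L[ℝ] E4 →L[ℝ] ℝ)) ↦ w.1.2.2.1 := by fun_prop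
    have hg'' : Continuous fun w : (E4 × (E4 →L[ℝ] E4 →L[ℝ] ℝ) × (E4 →L[ℝ] E4 →L[ℝ] E4 →L[ℝ] ℝ)
        × (E4 →L[ℝ] E4 →L[ℝ] E4 →L[ℝ] E4 →L[ℝ] ℝ))
        × ((E4 →L[ℝ] E4 →L[ℝ] ℝ) × (E4 →L[ℝ] E4 →L[ℝ] E4 →L[ℝ] ℝ)) ↦ w.1.2.2.2 := by fun_prop
    exact hx.prodMk (hg.prodMk ((hg'.add h1).prodMk (hg''.add (h2.add h3))))
  -- `ricciJet` is continuous at both jets (invertible value)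
  have hR := (contDiffOn_ricciJet (E := E4)).continuousOn
  have hR₁ : ContinuousAt (ricciJet (E := E4)) w₀.1 :=
    hR.continuousAt ((isOpen_ricciJetDomain (E := E4)).mem_nhds hw₀)
  have hR₂ : ContinuousAt (ricciJet (E := E4))
      (w₀.1.1, w₀.1.2.1, w₀.1.2.2.1 + (E4.dx 0).smulRight w₀.2.1,
        w₀.1.2.2.2 + ((E4.dx 0).smulRight w₀.2.2
          + (ContinuousLinearMap.smulRightL ℝ E4 (E4 →L[ℝ] E4 →L[ℝ] ℝ) (E4.dx 0)).comp w₀.2.2)) :=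
    hR.continuousAt ((isOpen_ricciJetDomain (E := E4)).mem_nhds hw₀)
  -- `♯ = (value)⁻¹ dx⁰`
  have hinv : ContinuousAt (fun w : (E4 × (E4 →L[ℝ] E4 →L[ℝ] ℝ) × (E4 →L[ℝ] E4 →L[ℝ] E4 →L[ℝ] ℝ)
        × (E4 →L[ℝ] E4 →L[ℝ] E4 →L[ℝ] E4 →L[ℝ] ℝ))
        × ((E4 →L[ℝ] E4 →L[ℝ] ℝ) × (E4 →L[ℝ] E4 →L[ℝ] E4 →L[ℝ] ℝ)) ↦
      w.1.2.1.inverse (E4.dx 0)) w₀ := by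
    have h := (hw₀.contDiffAt_map_inverse (n := 0)).continuousAt
    have h' : ContinuousAt (fun w : (E4 × (E4 →L[ℝ] E4 →L[ℝ] ℝ) × (E4 →L[ℝ] E4 →L[ℝ] E4 →L[ℝ] ℝ)
        × (E4 →L[ℝ] E4 →L[ℝ] E4 →L[ℝ] E4 →L[ℝ] ℝ))
        × ((E4 →L[ℝ] E4 →L[ℝ] ℝ) × (E4 →L[ℝ] E4 →L[ℝ] E4 →L[ℝ] ℝ)) ↦
        ContinuousLinearMap.inverse w.1.2.1) w₀ :=
      have hc : Continuous fun w : (E4 × (E4 →L[ℝ] E4 →L[ℝ] ℝ)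
          × (E4 →L[ℝ] E4 →L[ℝ] E4 →L[ℝ] ℝ) × (E4 →L[ℝ] E4 →L[ℝ] E4 →L[ℝ] E4 →L[ℝ] ℝ))
          × ((E4 →L[ℝ] E4 →L[ℝ] ℝ) × (E4 →L[ℝ] E4 →L[ℝ] E4 →L[ℝ] ℝ)) ↦ w.1.2.1 := by fun_prop
      ContinuousAt.comp (g := ContinuousLinearMap.inverse) h hc.continuousAt
    exact h'.clm_apply continuousAt_const
  have hA : ContinuousAt (fun w : (E4 × (E4 →L[ℝ] E4 →L[ℝ] ℝ) × (E4 →L[ℝ] E4 →L[ℝ] E4 →L[ℝ] ℝ)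
        × (E4 →L[ℝ] E4 →L[ℝ] E4 →L[ℝ] E4 →L[ℝ] ℝ))
        × ((E4 →L[ℝ] E4 →L[ℝ] ℝ) × (E4 →L[ℝ] E4 →L[ℝ] E4 →L[ℝ] ℝ)) ↦
      ricciJet (w.1.1, w.1.2.1, w.1.2.2.1 + (E4.dx 0).smulRight w.2.1,
          w.1.2.2.2 + ((E4.dx 0).smulRight w.2.2
            + (ContinuousLinearMap.smulRightL ℝ E4 (E4 →L[ℝ] E4 →L[ℝ] ℝ) (E4.dx 0)).comp w.2.2))) w₀ :=
    ContinuousAt.comp (g := ricciJet (E := E4)) hR₂ hJ.continuousAt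
  have hB : ContinuousAt (fun w : (E4 × (E4 →L[ℝ] E4 →L[ℝ] ℝ) × (E4 →L[ℝ] E4 →L[ℝ] E4 →L[ℝ] ℝ)
        × (E4 →L[ℝ] E4 →L[ℝ] E4 →L[ℝ] E4 →L[ℝ] ℝ))
        × ((E4 →L[ℝ] E4 →L[ℝ] ℝ) × (E4 →L[ℝ] E4 →L[ℝ] E4 →L[ℝ] ℝ)) ↦ ricciJet w.1) w₀ :=
    ContinuousAt.comp (g := ricciJet (E := E4)) hR₁ continuousAt_fst
  exact ((hA.clm_apply hinv).clm_apply continuousAt_const).sub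
    ((hB.clm_apply hinv).clm_apply continuousAt_const)

/-! ### The limit step -/

set_option maxHeartbeats 1600000 in
/-- **Limit step of the compactness argument.** Let `Sₙ → S₀`, `Aₙ → A₀`, `dₙ → d₀`, with
`r(S₀x) > 0` at the slice point `x`, and let `Gₙ` be metric components near `x` whose 2-jets at
`x` are asymptotic to those of the painted summands `z ↦ g(Sₙz)(Sₙ·,Sₙ·)`. Then the momentum rows
of the modulated models `Gₙ + x⁰Var_{(Sₙ,Aₙ,dₙ)}` at `x` converge to the row of the painted
summand with frame `S₀`, modulated by `Var_{(S₀,A₀,d₀)}`: the rows are continuous in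
(2-jet, `Var(x)`, `DVar(x)`) (`coerMomQ_continuousAt_rowFun`), and these data depend continuously
on `(S, A, d)` (`coerMomQ_contDiffAt_painted`, `coerMomQ_contDiffAt_var`). [folklore] -/
theorem coerMomQ_tendsto_row (M a : ℝ) {S A : ℕ → E4 →L[ℝ] E4} {d : ℕ → E4}
    {G : ℕ → E4 → E4 →L[ℝ] E4 →L[ℝ] ℝ} {V : ℕ → Set E4} {S₀ A₀ : E4 →L[ℝ] E4} {d₀ : E4}
    {U₀ : Set E4} {x : E4} (hx0 : x 0 = 0)
    (hS : Tendsto S atTop (𝓝 S₀)) (hA : Tendsto A atTop (𝓝 A₀)) (hd : Tendsto d atTop (𝓝 d₀))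
    (hr : 0 < Kerr.radius a (S₀ x))
    (hK₀ : IsMetricOn (fun z : E4 ↦ (Kerr.bilin M a (S₀ z)).bilinearComp S₀ S₀) U₀) (hxU₀ : x ∈ U₀)
    (hGV : ∀ᶠ n in atTop, IsMetricOn (G n) (V n) ∧ x ∈ V n)
    (h0 : Tendsto (fun n ↦ G n x - (Kerr.bilin M a (S n x)).bilinearComp (S n) (S n)) atTop (𝓝 0))
    (h1 : Tendsto (fun n ↦ fderiv ℝ (G n) x - fderiv ℝ (fun z : E4 ↦ (Kerr.bilin M a ((S n) z)).bilinearComp (S n) (S n)) x) atTop (𝓝 0))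
    (h2 : Tendsto (fun n ↦ fderiv ℝ (fderiv ℝ (G n)) x - fderiv ℝ (fderiv ℝ (fun z : E4 ↦ (Kerr.bilin M a ((S n) z)).bilinearComp (S n) (S n))) x)
      atTop (𝓝 0))
    (e : E4) :
    Tendsto (fun n ↦ (ricAt (fun z : E4 ↦ (G n) z + (z 0) • ((fderiv ℝ (Kerr.bilin M a) ((S n) z) ((A n) ((S n) z) + (d n))).bilinearComp (S n) (S n) + (Kerr.bilin M a ((S n) z)).bilinearComp ((A n).comp (S n)) (S n) + (Kerr.bilin M a ((S n) z)).bilinearComp (S n) ((A n).comp (S n)))) x (sharpAt (G n) x (E4.dx 0)) e - ricAt (G n) x (sharpAt (G n) x (E4.dx 0)) e)) atTop (𝓝 (ricAt (fun z : E4 ↦ (fun z : E4 ↦ (Kerr.bilin M a (S₀ z)).bilinearComp S₀ S₀) z + (z 0) • ((fderiv ℝ (Kerr.bilin M a) (S₀ z) (A₀ (S₀ z) + d₀)).bilinearComp S₀ S₀ + (Kerr.bilin M a (S₀ z)).bilinearComp (A₀.comp S₀) S₀ + (Kerr.bilin M a (S₀ z)).bilinearComp S₀ (A₀.comp S₀)))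 x (sharpAt (fun z : E4 ↦ (Kerr.bilin M a (S₀ z)).bilinearComp S₀ S₀) x (E4.dx 0)) e - ricAt (fun z : E4 ↦ (Kerr.bilin M a (S₀ z)).bilinearComp S₀ S₀) x (sharpAt (fun z : E4 ↦ (Kerr.bilin M a (S₀ z)).bilinearComp S₀ S₀) x (E4.dx 0)) e)) := by
  -- names for the painted summand and the first-variation field as functions of the parameters
  obtain ⟨KSf, hKSf⟩ : ∃ KSf : (E4 →L[ℝ] E4) → E4 → E4 →L[ℝ] E4 →L[ℝ] ℝ,
      KSf = fun T z ↦ (Kerr.bilin M a (T z)).bilinearComp T T := ⟨_, rfl⟩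
  obtain ⟨Vf, hVf⟩ : ∃ Vf : ((E4 →L[ℝ] E4) × (E4 →L[ℝ] E4) × E4) → E4 → E4 →L[ℝ] E4 →L[ℝ] ℝ,
      Vf = fun p z ↦ ((fderiv ℝ (Kerr.bilin M a) (p.1 z) (p.2.1 (p.1 z) + p.2.2)).bilinearComp p.1 p.1 + (Kerr.bilin M a (p.1 z)).bilinearComp (p.2.1.comp p.1) p.1 + (Kerr.bilin M a (p.1 z)).bilinearComp p.1 (p.2.1.comp p.1)) := ⟨_, rfl⟩
  -- smooth dependence of the painted jets on the frame
  have hP : ContDiffAt ℝ ∞ (uncurry KSf) (S₀, x) := by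
    rw [hKSf]
    exact coerMomQ_contDiffAt_painted M a (q₀ := (S₀, x)) hr
  obtain ⟨cK0, cK1, cK2⟩ := coerMomQ_contDiffAt_jets_param hP
  have tK0 : Tendsto (fun n ↦ KSf (S n) x) atTop (𝓝 (KSf S₀ x)) :=
    cK0.continuousAt.tendsto.comp hS
  have tK1 : Tendsto (fun n ↦ fderiv ℝ (KSf (S n)) x) atTop (𝓝 (fderiv ℝ (KSf S₀) x)) :=
    cK1.continuousAt.tendsto.comp hS
  have tK2 : Tendsto (fun n ↦ fderiv ℝ (fderiv ℝ (KSf (S n))) x) atTop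
      (𝓝 (fderiv ℝ (fderiv ℝ (KSf S₀)) x)) :=
    cK2.continuousAt.tendsto.comp hS
  -- hence convergence of the jets of `Gₙ`
  have h0' : Tendsto (fun n ↦ G n x - KSf (S n) x) atTop (𝓝 0) := by
    rw [hKSf]; exact h0
  have h1' : Tendsto (fun n ↦ fderiv ℝ (G n) x - fderiv ℝ (KSf (S n)) x) atTop (𝓝 0) := by
    rw [hKSf]; exact h1
  have h2' : Tendsto (fun n ↦ fderiv ℝ (fderiv ℝ (G n)) x - fderiv ℝ (fderiv ℝ (KSf (S n))) x)
      atTop (𝓝 0) := by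
    rw [hKSf]; exact h2
  have tG0 : Tendsto (fun n ↦ G n x) atTop (𝓝 (KSf S₀ x)) := by
    have h := h0'.add tK0
    rw [zero_add] at h
    exact h.congr fun n ↦ by simp only [sub_add_cancel]
  have tG1 : Tendsto (fun n ↦ fderiv ℝ (G n) x) atTop (𝓝 (fderiv ℝ (KSf S₀) x)) := by
    have h := h1'.add tK1
    rw [zero_add] at h
    exact h.congr fun n ↦ by simp only [sub_add_cancel]
  have tG2 : Tendsto (fun n ↦ fderiv ℝ (fderiv ℝ (G n)) x) atTop
      (𝓝 (fderiv ℝ (fderiv ℝ (KSf S₀)) x)) := by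
    have h := h2'.add tK2
    rw [zero_add] at h
    exact h.congr fun n ↦ by simp only [sub_add_cancel]
  -- smooth dependence of `(Var(x), DVar(x))` on `(S, A, d)`
  have hVar : ContDiffAt ℝ ∞ (uncurry Vf) ((S₀, A₀, d₀), x) := by
    have hρ : ContDiffAt ℝ ∞ (fun r : ((E4 →L[ℝ] E4) × (E4 →L[ℝ] E4) × E4) × E4 ↦
        ((r.1.1, r.1.2.1, r.1.2.2, r.2) : (E4 →L[ℝ] E4) × (E4 →L[ℝ] E4) × E4 × E4))
        ((S₀, A₀, d₀), x) := by fun_prop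
    have h := coerMomQ_contDiffAt_var M a (q₀ := (S₀, A₀, d₀, x)) hr
    have hc := h.comp ((S₀, A₀, d₀), x) hρ
    rw [hVf]
    exact hc
  obtain ⟨cV0, cV1, -⟩ := coerMomQ_contDiffAt_jets_param hVar
  have tp : Tendsto (fun n ↦ ((S n, A n, d n) : (E4 →L[ℝ] E4) × (E4 →L[ℝ] E4) × E4)) atTop
      (𝓝 (S₀, A₀, d₀)) := hS.prodMk_nhds (hA.prodMk_nhds hd)
  have tV0 : Tendsto (fun n ↦ Vf (S n, A n, d n) x) atTop (𝓝 (Vf (S₀, A₀, d₀) x)) :=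
    cV0.continuousAt.tendsto.comp tp
  have tV1 : Tendsto (fun n ↦ fderiv ℝ (Vf (S n, A n, d n)) x) atTop
      (𝓝 (fderiv ℝ (Vf (S₀, A₀, d₀)) x)) :=
    cV1.continuousAt.tendsto.comp tp
  -- the combined data and the continuity of the row functional
  have tw : Tendsto (fun n ↦ (((x, G n x, fderiv ℝ (G n) x, fderiv ℝ (fderiv ℝ (G n)) x),
      (Vf (S n, A n, d n) x, fderiv ℝ (Vf (S n, A n, d n)) x)) :
        (E4 × (E4 →L[ℝ] E4 →L[ℝ] ℝ) × (E4 →L[ℝ] E4 →L[ℝ] E4 →L[ℝ] ℝ)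
          × (E4 →L[ℝ] E4 →L[ℝ] E4 →L[ℝ] E4 →L[ℝ] ℝ))
          × ((E4 →L[ℝ] E4 →L[ℝ] ℝ) × (E4 →L[ℝ] E4 →L[ℝ] E4 →L[ℝ] ℝ)))) atTop
      (𝓝 ((x, KSf S₀ x, fderiv ℝ (KSf S₀) x, fderiv ℝ (fderiv ℝ (KSf S₀)) x),
        (Vf (S₀, A₀, d₀) x, fderiv ℝ (Vf (S₀, A₀, d₀)) x))) :=
    (tendsto_const_nhds.prodMk_nhds (tG0.prodMk_nhds (tG1.prodMk_nhds tG2))).prodMk_nhds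
      (tV0.prodMk_nhds tV1)
  have hinv : (KSf S₀ x).IsInvertible := by
    have h := hK₀.isInvertible x hxU₀
    rw [hKSf]
    exact h
  obtain ⟨R, hR⟩ : ∃ R : (E4 × (E4 →L[ℝ] E4 →L[ℝ] ℝ) × (E4 →L[ℝ] E4 →L[ℝ] E4 →L[ℝ] ℝ)
      × (E4 →L[ℝ] E4 →L[ℝ] E4 →L[ℝ] E4 →L[ℝ] ℝ))
      × ((E4 →L[ℝ] E4 →L[ℝ] ℝ) × (E4 →L[ℝ] E4 →L[ℝ] E4 →L[ℝ] ℝ)) → ℝ,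
      R = fun w ↦ ricciJet (w.1.1, w.1.2.1, w.1.2.2.1 + (E4.dx 0).smulRight w.2.1,
          w.1.2.2.2 + ((E4.dx 0).smulRight w.2.2
            + (ContinuousLinearMap.smulRightL ℝ E4 (E4 →L[ℝ] E4 →L[ℝ] ℝ) (E4.dx 0)).comp w.2.2))
          (w.1.2.1.inverse (E4.dx 0)) e
        - ricciJet w.1 (w.1.2.1.inverse (E4.dx 0)) e := ⟨_, rfl⟩
  have hcont : ContinuousAt R ((x, KSf S₀ x, fderiv ℝ (KSf S₀) x, fderiv ℝ (fderiv ℝ (KSf S₀)) x),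
      (Vf (S₀, A₀, d₀) x, fderiv ℝ (Vf (S₀, A₀, d₀)) x)) := by
    rw [hR]
    exact coerMomQ_continuousAt_rowFun e hinv
  have hlim := hcont.tendsto.comp tw
  -- eventually positive painted radius along `Sₙ`
  have hrn : ∀ᶠ n in atTop, 0 < Kerr.radius a (S n x) := by
    have hc : Continuous fun T : E4 →L[ℝ] E4 ↦ Kerr.radius a (T x) :=
      (Kerr.continuous_radius a).comp (continuous_id.clm_apply continuous_const)
    exact (hc.tendsto S₀ |>.comp hS).eventually_const_lt hr
  -- identification of the terms and of the limit
  have key : ∀ (G' : E4 → E4 →L[ℝ] E4 →L[ℝ] ℝ) (V' : Set E4) (T B : E4 →L[ℝ] E4) (c : E4),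
      IsMetricOn G' V' → x ∈ V' → 0 < Kerr.radius a (T x) →
      (ricAt (fun z : E4 ↦ G' z + (z 0) • ((fderiv ℝ (Kerr.bilin M a) (T z) (B (T z) + c)).bilinearComp T T + (Kerr.bilin M a (T z)).bilinearComp (B.comp T) T + (Kerr.bilin M a (T z)).bilinearComp T (B.comp T))) x (sharpAt G' x (E4.dx 0)) e - ricAt G' x (sharpAt G' x (E4.dx 0)) e)
        = R ((x, G' x, fderiv ℝ G' x, fderiv ℝ (fderiv ℝ G') x),
            (Vf (T, B, c) x, fderiv ℝ (Vf (T, B, c)) x)) := by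
    intro G' V' T B c hG' hxV' hT
    rw [coerMomQ_row_eq_ricciJet hG' hxV' hx0 M a T B c hT e, hR, hVf]
    rfl
  have hlim' := hlim.congr' (by
    filter_upwards [hGV, hrn] with n hn hn'
    exact (key (G n) (V n) (S n) (A n) (d n) hn.1 hn.2 hn').symm)
  have hK₀' : IsMetricOn (KSf S₀) U₀ := by rw [hKSf]; exact hK₀
  rw [← key (KSf S₀) U₀ S₀ A₀ d₀ hK₀' hxU₀ hr] at hlim'
  rw [hKSf] at hlim'
  exact hlim'

/-- **Registered one-line carrier form** (`coerMomQ_tendsto_clm_apply_bs`) of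
`coerMomQ_tendsto_clm_apply` on `E4`-sequences. [folklore] -/
theorem coerMomQ_tendsto_clm_apply_bs : open Literature.Geometry.Lorentzian Filter Topology in ∀ {f : ℕ → E4 →L[ℝ] E4} {g : ℕ → E4} {φ : E4 →L[ℝ] E4} {u : E4}, Tendsto f atTop (𝓝 φ) → Tendsto g atTop (𝓝 u) → Tendsto (fun i ↦ f i (g i)) atTop (𝓝 (φ u)) :=
  fun hf hg ↦ coerMomQ_tendsto_clm_apply hf hg

end Summit.FinalStateConjecture.FinalStateConjecture.Theorems.SublinearIsFree.Slaving

end
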